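import Mathlib.RingTheory.MvPolynomial.Homogeneous
import Mathlib.RingTheory.Ideal.Quotient.Operations
import HarnessLib

/-!
# Shioda–Katsura's inductive structure of Fermat varieties: the rational map of Lemma 1.1
# in the "general sum" form of Remark 1.10

T. Shioda, T. Katsura, *On Fermat varieties*, Tôhoku Math. J. 31 (1979) 97–115, §1
[ShiodaKatsura1979]. With `Xʳₘ : x₀ᵐ + ⋯ + x_{r+1}ᵐ = 0 ⊂ ℙ^{r+1}` the Fermat variety:

> **Lemma 1.1.** There exists a rational map of degree `m`, `φ : Xʳₘ × Xˢₘ ⇢ X^{r+s}ₘ` (1.2), defined by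
> (1.3) `zᵢ = xᵢ y_{s+1}` (`i = 0, 1, …, r`), `z_{r+1+j} = ε x_{r+1} y_j` (`j = 0, 1, …, s`), `ε` being a
> fixed `2m`-th root of unity such that `εᵐ = -1`. PROOF. Immediate.
> Let `Y` denote the locus of points of `Xʳₘ × Xˢₘ` where the rational map `φ` is not defined. Then
> `Y` is the subvariety of `Xʳₘ × Xˢₘ` defined by `x_{r+1} = y_{s+1} = 0`, which can be naturally
> identified with `X^{r-1}ₘ × X^{s-1}ₘ`.
> (1.17) [the `μₘ`-action on `Xʳₘ × Xˢₘ`]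
> `(x₀ : … : x_{r+1}), (y₀ : … : y_{s+1}) ↦ ((x₀ : … : x_r : ζ x_{r+1}), (y₀ : … : y_s : ζ y_{s+1}))`
> (`ζ ∈ μₘ`). The fixed point set of this action is the subvariety `Y` defined before […]
> **Remark 1.10.** The proof given above for Theorem 1.7 can be applied to a slightly more general
> situation. Namely, let `Xʳₘ` (or `Xˢₘ`) denote for a moment arbitrary non-singular hypersurface of
> degree `m` defined by `f(x₀, …, x_r) + x_{r+1}ᵐ = 0` (or `g(y₀, …, y_s) + y_{s+1}ᵐ = 0`) and let
> `X^{r-1}ₘ, X^{s-1}ₘ, X^{r+s}ₘ` respectively denote the hypersurfaces (1.1)′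
> `f(x₀, …, x_r) = 0`, `g(y₀, …, y_s) = 0`, `f(x₀, …, x_r) + g(y₀, …, y_s) = 0`.
> Then `X^{r+s}ₘ` is obtained from the product `Xʳₘ × Xˢₘ` by exactly the same steps as those
> described in Theorem 1.7 for the case of Fermat varieties.

(The displayed formulas (1.1)′, (1.3), (1.17) are transcribed from the printed page; the held scan
`paper:url-2b12de8f7b5b` drops display mathematics, and the substitution is confirmed verbatim by
K. Koike, arXiv:2106.06117, before Thm. 1.5: `[x] × [y] ↦ [y₃x₀ : y₃x₁ : y₃x₂ : x₃y₀ : x₃y₁ : x₃y₂]`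
for `F₁(x) = x₃ᵈ`, `F₂(y) = y₃ᵈ`, `X : F₁ = F₂` — the same map with the sign of `g` absorbed.)

## What is formalised (all PROVED, polynomial identities over an arbitrary commutative ring `R`)

We index the coordinates of `ℙ^{r+1} ∋ x` by `Option α` (`some a ↦ x_a`, `none ↦ x_{r+1}`), those of
`ℙ^{s+1} ∋ y` by `Option β`, and those of `ℙ^{r+s+1} ∋ z` by `α ⊕ β`; nothing requires
`α = Fin (r+1)`, so the statements are uniform in `r, s`.

* `coneForm m f = f(x) + x_∞ᵐ` and `sumForm f g = f(z') + g(z'')` — the hypersurfaces of (1.1)′;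
  for `f, g` Fermat forms these are the Fermat forms in `r+2`, resp. `r+s+2`, variables
  (`coneForm_fermat`, `sumForm_fermat`), i.e. Lemma 1.1 proper is the special case.
* `skSubst ε`, `skMap ε` — the substitution (1.3) as an `R`-algebra map on homogeneous coordinate
  rings, and the KEY IDENTITY (Lemma 1.1 "Immediate" / Remark 1.10), for `f, g` homogeneous of
  degree `m` and `εᵐ = -1`:
  `φ^*(f(z') + g(z'')) = y_∞ᵐ · (f(x) + x_∞ᵐ) − x_∞ᵐ · (g(y) + y_∞ᵐ)`  (`skMap_sumForm`),
  hence `φ^*` of the equation of `X^{r+s}` lies in the ideal of `Xʳ × Xˢ` (`skMap_sumForm_mem_span`):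
  the rational map lands in `X^{r+s}`.
* The indeterminacy sentence: every coordinate of `φ` vanishes on `Y = {x_∞ = y_∞ = 0}`
  (`span_skSubst_le`), and conversely on `Xʳ × Xˢ` the common zeros of the coordinates of `φ` lie in
  `{x_∞ = 0}` and in `{y_∞ = 0}` — in saturated form `(x_∞ · y_w)ᵐ ∈ ⟨φ^* z⟩ + ⟨g(y) + y_∞ᵐ⟩` for EVERY
  homogeneous coordinate `y_w` (`baseLocus_inl_none`, `baseLocus_inr_none`); and `Y ≅ V(f) × V(g)`:
  killing `x_∞` in `coneForm m f` returns `f` (`coneForm_kill_none`).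
* (1.17): the `μₘ`-twist `γ_ζ` multiplies every coordinate of `φ` by `ζ` (`twist_skSubst`,
  `twist_skMap` for homogeneous arguments) — so `φ ∘ γ_ζ = φ` projectively — and preserves the
  equations of `Xʳ × Xˢ` when `ζᵐ = 1` (`twist_coneForm_inl`, `twist_coneForm_inr`).

NOT formalised here (no schemes in this file): `deg φ = m`, the blow-up/quotient/blow-down diagram
of Theorem 1.7 and its cohomological form Prop. 2.4 (2.5) — for FERMAT varieties the tree treats
those in `Literature/AlgebraicGeometry/HodgeTheory/FermatBlowupHostsPackage.lean`,
`FermatLevelMap.lean`, `FermatShiodaCondition.lean`. With `α = Fin (r+1)` and the equivalence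
`Option (Fin (r+1)) ≃ Fin (r+2)`, `coneForm m (∑ xᵢᵐ)` is the tree's
`Literature.AlgebraicGeometry.Motives.fermatPolynomial k r m` up to that reindexing (not imported, to
keep this file free of scheme theory).

## References
* [ShiodaKatsura1979] T. Shioda, T. Katsura, On Fermat varieties, Tôhoku Math. J. 31 (1979)
  97–115, §1: Lemma 1.1, (1.2)–(1.4), (1.17), Thm. 1.7, Remarks 1.8–1.10, Cor. 1.11.
* K. Koike, On cubic fourfolds with an inductive structure, arXiv:2106.06117, Thm. 1.5 (the `3+3`
  case `F₁(x₀,x₁,x₂) = F₂(y₀,y₁,y₂)` of Remark 1.10, with the induced isomorphism on `H⁴_prim`).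
-/

namespace Literature.AlgebraicGeometry.ShiodaKatsura1979

open MvPolynomial

universe u v w

variable {R : Type u} [CommRing R] {α : Type v} {β : Type w}

/-! ### Two folklore helpers on homogeneous polynomials (private) -/

/-- Scaling the arguments of a homogeneous polynomial of degree `n` by `c` scales its value by
`cⁿ`: `φ(c·y) = cⁿ φ(y)` (private helper; the same lemma is proved in
`Literature.Computability.AlgebraicComplexity.AlderStrassenProofs`, not imported here). [folklore] -/
private theorem aeval_const_mul_of_isHomogeneous {S : Type*} [CommRing S] [Algebra R S]
    {σ : Type*} {φ : MvPolynomial σ R} {n : ℕ} (hφ : φ.IsHomogeneous n) (c : S) (y : σ → S) :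
    aeval (fun i => c * y i) φ = c ^ n * aeval y φ := by
  conv_lhs => rw [← φ.support_sum_monomial_coeff]
  conv_rhs => rw [← φ.support_sum_monomial_coeff]
  rw [map_sum, map_sum, Finset.mul_sum]
  refine Finset.sum_congr rfl fun s hs => ?_
  rw [aeval_monomial, aeval_monomial, hφ.degree_eq_sum_deg_support hs, Finsupp.prod, Finsupp.prod,
    Finset.prod_congr rfl fun i _ => mul_pow c (y i) (s i), Finset.prod_mul_distrib,
    Finset.prod_pow_eq_pow_sum, mul_left_comm]

/-- A homogeneous polynomial of POSITIVE degree evaluated at elements of an ideal `I` lies in `I`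
(it has no constant term) (private helper). [folklore] -/
private theorem aeval_mem_of_isHomogeneous {S : Type*} [CommRing S] [Algebra R S]
    {σ : Type*} {φ : MvPolynomial σ R} {n : ℕ} (hφ : φ.IsHomogeneous n) (hn : n ≠ 0)
    (I : Ideal S) (y : σ → S) (hy : ∀ i, y i ∈ I) : aeval y φ ∈ I := by
  rw [← Ideal.Quotient.eq_zero_iff_mem]
  have h1 : Ideal.Quotient.mk I (aeval y φ) = aeval (fun i => Ideal.Quotient.mk I (y i)) φ := by
    rw [← Ideal.Quotient.mkₐ_eq_mk R, ← AlgHom.comp_apply, comp_aeval]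
  have h2 : (fun i => Ideal.Quotient.mk I (y i)) = fun _ => (0 : S ⧸ I) :=
    funext fun i => (Ideal.Quotient.eq_zero_iff_mem).2 (hy i)
  have h3 : constantCoeff φ = 0 := by
    rw [constantCoeff_eq]
    exact hφ.coeff_eq_zero (by simpa using hn.symm)
  rw [h1, h2, aeval_zero', h3, map_zero]

/-! ### The hypersurfaces (1.1)′ -/

/-- The CONE FORM `f(x₀,…,x_r) + x_{r+1}ᵐ` of a form `f` in the variables `α` (`x_a = X (some a)`,
the extra variable `x_{r+1} = x_∞ = X none`): the equation of Shioda–Katsura's `Xʳₘ` in the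
general-sum setting of Remark 1.10 (for `f = ∑ x_aᵐ` it is the Fermat form in `r+2` variables,
`coneForm_fermat`). [cite: ShiodaKatsura1979, §1 Remark 1.10] -/
noncomputable def coneForm (m : ℕ) (f : MvPolynomial α R) : MvPolynomial (Option α) R :=
  rename some f + X none ^ m

/-- The SUM FORM `f(x₀,…,x_r) + g(y₀,…,y_s)` in the disjoint union of the two sets of variables:
the equation (1.1)′ of `X^{r+s}ₘ ⊂ ℙ^{r+s+1}` (for Fermat forms `f, g` it is the Fermat form in
`r+s+2` variables, `sumForm_fermat`). [cite: ShiodaKatsura1979, §1 Remark 1.10 (1.1)′] -/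
noncomputable def sumForm (f : MvPolynomial α R) (g : MvPolynomial β R) :
    MvPolynomial (α ⊕ β) R :=
  rename Sum.inl f + rename Sum.inr g

/-- `coneForm m (∑_a x_aᵐ) = ∑_{v : Option α} x_vᵐ`: the cone form of the Fermat form in `r+1`
variables is the Fermat form in `r+2` variables (equation (0.1)/(1.1) of `Xʳₘ`).
[cite: ShiodaKatsura1979, §1 (1.1)] -/
theorem coneForm_fermat [Fintype α] (m : ℕ) :
    coneForm m (∑ a : α, X a ^ m : MvPolynomial α R) = ∑ v : Option α, X v ^ m := by
  simp [coneForm, map_sum, map_pow, rename_X, Fintype.sum_option, add_comm]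

/-- `sumForm (∑_a x_aᵐ) (∑_b y_bᵐ) = ∑_{v : α ⊕ β} z_vᵐ`: the sum form of two Fermat forms is the
Fermat form of `X^{r+s}ₘ`. [cite: ShiodaKatsura1979, §1 (1.1)] -/
theorem sumForm_fermat [Fintype α] [Fintype β] (m : ℕ) :
    sumForm (∑ a : α, X a ^ m : MvPolynomial α R) (∑ b : β, X b ^ m : MvPolynomial β R) =
      ∑ v : α ⊕ β, X v ^ m := by
  simp [sumForm, map_sum, map_pow, rename_X, Fintype.sum_sum_type]

/-- Killing the cone variable `x_∞` in `f(x) + x_∞ᵐ` (`m ≠ 0`) returns `f`: the indeterminacy locus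
`Y = {x_{r+1} = y_{s+1} = 0} ⊂ Xʳ × Xˢ` "can be naturally identified with `X^{r-1} × X^{s-1}`",
the hypersurfaces `f = 0`, `g = 0` of (1.1)′. [cite: ShiodaKatsura1979, §1 after Lemma 1.1; Remark 1.10] -/
theorem coneForm_kill_none {m : ℕ} (hm : m ≠ 0) (f : MvPolynomial α R) :
    aeval (fun v : Option α => v.elim 0 X) (coneForm m f) = f := by
  rw [coneForm, map_add, map_pow, aeval_X, aeval_rename]
  have h : ((fun v : Option α => v.elim (0 : MvPolynomial α R) X) ∘ some) = X := by
    funext a; simp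
  rw [h, aeval_X_left_apply]
  simp [zero_pow hm]

/-! ### The substitution (1.3) and the key identity -/

/-- Shioda–Katsura's substitution (1.3): `z_a ↦ x_a · y_∞` (`a ∈ α`, i.e. `i = 0,…,r`) and
`z_b ↦ ε · x_∞ · y_b` (`b ∈ β`, i.e. `z_{r+1+j} = ε x_{r+1} y_j`), on the variables of
`ℙ^{r+1} × ℙ^{s+1}` indexed by `Option α ⊕ Option β`. [cite: ShiodaKatsura1979, §1 Lemma 1.1 (1.3)] -/
noncomputable def skSubst (ε : R) : α ⊕ β → MvPolynomial (Option α ⊕ Option β) R :=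
  Sum.elim (fun a => X (Sum.inl (some a)) * X (Sum.inr none))
    (fun b => C ε * X (Sum.inl none) * X (Sum.inr (some b)))

/-- The pull-back `φ^*` along Shioda–Katsura's rational map `φ : ℙ^{r+1} × ℙ^{s+1} ⇢ ℙ^{r+s+1}`
(1.2)–(1.3), as an `R`-algebra map of homogeneous coordinate rings.
[cite: ShiodaKatsura1979, §1 Lemma 1.1 (1.2)–(1.3)] -/
noncomputable def skMap (ε : R) :
    MvPolynomial (α ⊕ β) R →ₐ[R] MvPolynomial (Option α ⊕ Option β) R :=
  aeval (skSubst ε)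

/-- (1.3), first block: `z_i = x_i y_{s+1}`. [cite: ShiodaKatsura1979, §1 Lemma 1.1 (1.3)] -/
@[simp] theorem skSubst_inl (ε : R) (a : α) :
    (skSubst ε (Sum.inl a) : MvPolynomial (Option α ⊕ Option β) R) =
      X (Sum.inl (some a)) * X (Sum.inr none) := rfl

/-- (1.3), second block: `z_{r+1+j} = ε x_{r+1} y_j`. [cite: ShiodaKatsura1979, §1 Lemma 1.1 (1.3)] -/
@[simp] theorem skSubst_inr (ε : R) (b : β) :
    (skSubst ε (Sum.inr b) : MvPolynomial (Option α ⊕ Option β) R) =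
      C ε * X (Sum.inl none) * X (Sum.inr (some b)) := rfl

/-- `φ^*(z_v)` is the substitution (1.3). [cite: ShiodaKatsura1979, §1 Lemma 1.1 (1.3)] -/
@[simp] theorem skMap_X (ε : R) (v : α ⊕ β) :
    skMap ε (X v : MvPolynomial (α ⊕ β) R) = skSubst ε v := by
  simp [skMap]

/-- On the `x`-block: for `f` homogeneous of degree `m`, `φ^*(f(z')) = y_∞ᵐ · f(x)`.
[cite: ShiodaKatsura1979, §1 Lemma 1.1 (proof: "Immediate")] -/
theorem skMap_rename_inl (ε : R) {m : ℕ} {f : MvPolynomial α R} (hf : f.IsHomogeneous m) :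
    skMap (α := α) (β := β) ε (rename Sum.inl f) =
      X (Sum.inr none) ^ m * rename (Sum.inl ∘ some) f := by
  unfold skMap
  rw [aeval_rename]
  have h : skSubst (α := α) (β := β) ε ∘ Sum.inl =
      fun a : α => X (Sum.inr none) * (X (Sum.inl (some a)) :
        MvPolynomial (Option α ⊕ Option β) R) := by
    funext a; simp [mul_comm]
  rw [h, aeval_const_mul_of_isHomogeneous hf, ← aeval_X_left_apply (rename (Sum.inl ∘ some) f),
    aeval_rename]
  rfl

/-- On the `y`-block: for `g` homogeneous of degree `m`, `φ^*(g(z'')) = (ε x_∞)ᵐ · g(y)`.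
[cite: ShiodaKatsura1979, §1 Lemma 1.1 (proof: "Immediate")] -/
theorem skMap_rename_inr (ε : R) {m : ℕ} {g : MvPolynomial β R} (hg : g.IsHomogeneous m) :
    skMap (α := α) (β := β) ε (rename Sum.inr g) =
      (C ε * X (Sum.inl none)) ^ m * rename (Sum.inr ∘ some) g := by
  unfold skMap
  rw [aeval_rename]
  have h : skSubst (α := α) (β := β) ε ∘ Sum.inr =
      fun b : β => (C ε * X (Sum.inl none)) * (X (Sum.inr (some b)) :
        MvPolynomial (Option α ⊕ Option β) R) := by
    funext b; simp
  rw [h, aeval_const_mul_of_isHomogeneous hg, ← aeval_X_left_apply (rename (Sum.inr ∘ some) g),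
    aeval_rename]
  rfl

/-- **Shioda–Katsura, Lemma 1.1 / Remark 1.10 — the raw pull-back.** For forms `f, g` of degree `m`:
`φ^*(f(z') + g(z'')) = y_∞ᵐ f(x) + εᵐ x_∞ᵐ g(y)`. [cite: ShiodaKatsura1979, §1 Lemma 1.1, Remark 1.10] -/
theorem skMap_sumForm_eq (ε : R) {m : ℕ} {f : MvPolynomial α R} {g : MvPolynomial β R}
    (hf : f.IsHomogeneous m) (hg : g.IsHomogeneous m) :
    skMap ε (sumForm f g) =
      X (Sum.inr none) ^ m * rename (Sum.inl ∘ some) f +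
        C ε ^ m * X (Sum.inl none) ^ m * rename (Sum.inr ∘ some) g := by
  rw [sumForm, map_add, skMap_rename_inl ε hf, skMap_rename_inr ε hg, mul_pow]

/-- The equation of `Xʳ` pulled to the product: `f(x) + x_∞ᵐ` in the variables `Option α ⊕ Option β`
unfolds as `f(x) + x_∞ᵐ`. [cite: ShiodaKatsura1979, §1 Remark 1.10] -/
theorem rename_inl_coneForm (m : ℕ) (f : MvPolynomial α R) :
    (rename Sum.inl (coneForm m f) : MvPolynomial (Option α ⊕ Option β) R) =
      rename (Sum.inl ∘ some) f + X (Sum.inl none) ^ m := by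
  simp [coneForm, map_add, map_pow, rename_rename, rename_X]

/-- The equation of `Xˢ` pulled to the product. [cite: ShiodaKatsura1979, §1 Remark 1.10] -/
theorem rename_inr_coneForm (m : ℕ) (g : MvPolynomial β R) :
    (rename Sum.inr (coneForm m g) : MvPolynomial (Option α ⊕ Option β) R) =
      rename (Sum.inr ∘ some) g + X (Sum.inr none) ^ m := by
  simp [coneForm, map_add, map_pow, rename_rename, rename_X]

/-- **Shioda–Katsura, Lemma 1.1 in the general-sum form of Remark 1.10 — the key identity.**
For forms `f(x₀,…,x_r)`, `g(y₀,…,y_s)` of degree `m` and `ε` with `εᵐ = -1`, the substitution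
(1.3) `z_a = x_a y_∞`, `z_b = ε x_∞ y_b` satisfies, identically in `R[x, y]`,
`f(z') + g(z'') = y_∞ᵐ · (f(x) + x_∞ᵐ) − x_∞ᵐ · (g(y) + y_∞ᵐ)`.
In particular `φ` maps `{f(x) + x_∞ᵐ = 0} × {g(y) + y_∞ᵐ = 0}` into `{f + g = 0}` ("PROOF. Immediate").
[cite: ShiodaKatsura1979, §1 Lemma 1.1, Remark 1.10] -/
theorem skMap_sumForm (ε : R) {m : ℕ} (hε : ε ^ m = -1) {f : MvPolynomial α R}
    {g : MvPolynomial β R} (hf : f.IsHomogeneous m) (hg : g.IsHomogeneous m) :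
    skMap ε (sumForm f g) =
      X (Sum.inr none) ^ m * rename Sum.inl (coneForm m f) -
        X (Sum.inl none) ^ m * rename Sum.inr (coneForm m g) := by
  rw [skMap_sumForm_eq ε hf hg, rename_inl_coneForm, rename_inr_coneForm, ← map_pow, hε, map_neg,
    map_one]
  ring

/-- **Corollary (the rational map lands in `X^{r+s}`).** `φ^*(f + g)` lies in the ideal generated by
the equations of `Xʳ × Xˢ`. [cite: ShiodaKatsura1979, §1 Lemma 1.1 (1.2), Remark 1.10] -/
theorem skMap_sumForm_mem_span (ε : R) {m : ℕ} (hε : ε ^ m = -1) {f : MvPolynomial α R}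
    {g : MvPolynomial β R} (hf : f.IsHomogeneous m) (hg : g.IsHomogeneous m) :
    skMap ε (sumForm f g) ∈
      Ideal.span {rename Sum.inl (coneForm m f), rename Sum.inr (coneForm m g)} := by
  rw [skMap_sumForm ε hε hf hg]
  refine Ideal.sub_mem _ (Ideal.mul_mem_left _ _ (Ideal.subset_span (by simp)))
    (Ideal.mul_mem_left _ _ (Ideal.subset_span (by simp)))

/-- **Lemma 1.1 as printed (Fermat varieties).** With `εᵐ = -1`,
`∑_v z_vᵐ ∘ φ = y_{s+1}ᵐ · (∑ x_iᵐ) − x_{r+1}ᵐ · (∑ y_jᵐ)`, so `φ : Xʳₘ × Xˢₘ ⇢ X^{r+s}ₘ`.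
[cite: ShiodaKatsura1979, §1 Lemma 1.1] -/
theorem skMap_fermat [Fintype α] [Fintype β] (ε : R) {m : ℕ} (hε : ε ^ m = -1) :
    skMap ε (∑ v : α ⊕ β, X v ^ m : MvPolynomial (α ⊕ β) R) =
      X (Sum.inr none) ^ m * rename Sum.inl (∑ v : Option α, X v ^ m) -
        X (Sum.inl none) ^ m * rename Sum.inr (∑ v : Option β, X v ^ m) := by
  have hf : (∑ a : α, X a ^ m : MvPolynomial α R).IsHomogeneous m :=
    IsHomogeneous.sum _ _ _ fun a _ => by simpa using (isHomogeneous_X R a).pow m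
  have hg : (∑ b : β, X b ^ m : MvPolynomial β R).IsHomogeneous m :=
    IsHomogeneous.sum _ _ _ fun b _ => by simpa using (isHomogeneous_X R b).pow m
  rw [← sumForm_fermat, skMap_sumForm ε hε hf hg, coneForm_fermat, coneForm_fermat]

/-- `φ(Xʳₘ × Xˢₘ) ⊂ X^{r+s}ₘ`: the Fermat form of `ℙ^{r+s+1}` pulls back into the ideal of
`Xʳₘ × Xˢₘ ⊂ ℙ^{r+1} × ℙ^{s+1}`. [cite: ShiodaKatsura1979, §1 Lemma 1.1 (1.2)] -/
theorem skMap_fermat_mem_span [Fintype α] [Fintype β] (ε : R) {m : ℕ} (hε : ε ^ m = -1) :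
    skMap ε (∑ v : α ⊕ β, X v ^ m : MvPolynomial (α ⊕ β) R) ∈
      Ideal.span {rename Sum.inl (∑ v : Option α, X v ^ m : MvPolynomial (Option α) R),
        rename Sum.inr (∑ v : Option β, X v ^ m : MvPolynomial (Option β) R)} := by
  rw [skMap_fermat ε hε]
  refine Ideal.sub_mem _ (Ideal.mul_mem_left _ _ (Ideal.subset_span (by simp)))
    (Ideal.mul_mem_left _ _ (Ideal.subset_span (by simp)))

/-! ### The indeterminacy locus `Y = {x_{r+1} = y_{s+1} = 0}` -/

/-- Every coordinate `φ^*(z_v)` of `φ` vanishes on `Y = {x_∞ = y_∞ = 0}`: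
`⟨φ^* z_v : v⟩ ≤ ⟨x_∞, y_∞⟩`. [cite: ShiodaKatsura1979, §1 after Lemma 1.1 ("Y … defined by x_{r+1} = y_{s+1} = 0")] -/
theorem span_skSubst_le (ε : R) :
    Ideal.span (Set.range (skSubst (α := α) (β := β) ε)) ≤
      Ideal.span {X (Sum.inl none), X (Sum.inr none)} := by
  refine Ideal.span_le.2 ?_
  rintro _ ⟨v, rfl⟩
  rcases v with a | b
  · simp only [skSubst_inl, SetLike.mem_coe]
    exact Ideal.mul_mem_left _ _ (Ideal.subset_span (by simp))
  · simp only [skSubst_inr, SetLike.mem_coe]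
    exact Ideal.mul_mem_right _ _ (Ideal.mul_mem_left _ _ (Ideal.subset_span (by simp)))

/-- Conversely, first half: on `Xʳ × Xˢ` the common zeros of the coordinates of `φ` lie in
`{y_∞ = 0} ∪ {x_w = 0 ∀ w}` — and all `x_w` (projective coordinates of `ℙ^{r+1}`) never vanish
together — i.e. in `{y_∞ = 0}`. Saturated form: `(y_∞ · x_w)ᵐ ∈ ⟨φ^* z⟩ + ⟨f(x) + x_∞ᵐ⟩` for EVERY
`w : Option α` (`f` a form of degree `m ≥ 1`).
[cite: ShiodaKatsura1979, §1 after Lemma 1.1 ("Y … defined by x_{r+1} = y_{s+1} = 0")] -/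
theorem baseLocus_inl {m : ℕ} (hm : m ≠ 0) (ε : R) {f : MvPolynomial α R}
    (hf : f.IsHomogeneous m) (w : Option α) :
    (X (Sum.inr none) * X (Sum.inl w)) ^ m ∈
      Ideal.span (Set.range (skSubst (α := α) (β := β) ε)) ⊔
        Ideal.span {rename Sum.inl (coneForm m f)} := by
  set I : Ideal (MvPolynomial (Option α ⊕ Option β) R) := Ideal.span (Set.range (skSubst ε))
  -- the `x`-coordinates of `φ` are in `I`
  have hx : ∀ a : α, X (Sum.inr none) * X (Sum.inl (some a)) ∈ I := fun a => by
    rw [mul_comm]; exact Ideal.subset_span ⟨Sum.inl a, rfl⟩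
  rcases w with _ | a
  · -- `(y_∞ x_∞)^m = y_∞^m (f + x_∞^m) - y_∞^m f(x)`, and `y_∞^m f(x) = f(y_∞ x) ∈ I`
    have h1 : X (Sum.inr none) ^ m * rename (Sum.inl ∘ some) f ∈ I := by
      rw [← aeval_X_left_apply (rename (Sum.inl ∘ some) f), aeval_rename,
        ← aeval_const_mul_of_isHomogeneous hf]
      exact aeval_mem_of_isHomogeneous hf hm I _ hx
    have h2 : ((X (Sum.inr none) * X (Sum.inl none)) ^ m : MvPolynomial (Option α ⊕ Option β) R) =
        X (Sum.inr none) ^ m * rename Sum.inl (coneForm m f) -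
          X (Sum.inr none) ^ m * rename (Sum.inl ∘ some) f := by
      rw [rename_inl_coneForm]; ring
    rw [h2]
    exact Ideal.sub_mem _ (Ideal.mem_sup_right (Ideal.mul_mem_left _ _
      (Ideal.subset_span rfl))) (Ideal.mem_sup_left h1)
  · exact Ideal.mem_sup_left (Ideal.pow_mem_of_mem _ (hx a) _ (Nat.pos_of_ne_zero hm))

/-- Conversely, second half: on `Xʳ × Xˢ` the common zeros of the coordinates of `φ` lie in
`{x_∞ = 0}`: `(x_∞ · y_w)ᵐ ∈ ⟨φ^* z⟩ + ⟨g(y) + y_∞ᵐ⟩` for every `w : Option β` (`g` a form of degree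
`m ≥ 1`, `ε` a unit — in the source `ε^{2m} = 1`). Together with `baseLocus_inl` and
`span_skSubst_le`: the indeterminacy locus of `φ` on `Xʳ × Xˢ` is exactly `Y = {x_{r+1} = y_{s+1} = 0}`.
[cite: ShiodaKatsura1979, §1 after Lemma 1.1 ("Y … defined by x_{r+1} = y_{s+1} = 0")] -/
theorem baseLocus_inr {m : ℕ} (hm : m ≠ 0) {ε : R} (hε : IsUnit ε) {g : MvPolynomial β R}
    (hg : g.IsHomogeneous m) (w : Option β) :
    (X (Sum.inl none) * X (Sum.inr w)) ^ m ∈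
      Ideal.span (Set.range (skSubst (α := α) (β := β) ε)) ⊔
        Ideal.span {rename Sum.inr (coneForm m g)} := by
  set I : Ideal (MvPolynomial (Option α ⊕ Option β) R) := Ideal.span (Set.range (skSubst ε))
  obtain ⟨u, rfl⟩ := hε
  -- the `y`-coordinates of `φ`, divided by the unit `ε`, are in `I`
  have hy : ∀ b : β, X (Sum.inl none) * X (Sum.inr (some b)) ∈ I := fun b => by
    have hb : C (u : R) * X (Sum.inl none) * X (Sum.inr (some b)) ∈ I :=
      Ideal.subset_span ⟨Sum.inr b, rfl⟩
    have := Ideal.mul_mem_left I (C (↑u⁻¹ : R)) hb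
    rwa [← mul_assoc, ← mul_assoc, ← map_mul, Units.inv_mul, map_one, one_mul] at this
  rcases w with _ | b
  · have h1 : X (Sum.inl none) ^ m * rename (Sum.inr ∘ some) g ∈ I := by
      rw [← aeval_X_left_apply (rename (Sum.inr ∘ some) g), aeval_rename,
        ← aeval_const_mul_of_isHomogeneous hg]
      exact aeval_mem_of_isHomogeneous hg hm I _ hy
    have h2 : ((X (Sum.inl none) * X (Sum.inr none)) ^ m : MvPolynomial (Option α ⊕ Option β) R) =
        X (Sum.inl none) ^ m * rename Sum.inr (coneForm m g) -
          X (Sum.inl none) ^ m * rename (Sum.inr ∘ some) g := by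
      rw [rename_inr_coneForm]; ring
    rw [h2]
    exact Ideal.sub_mem _ (Ideal.mem_sup_right (Ideal.mul_mem_left _ _
      (Ideal.subset_span rfl))) (Ideal.mem_sup_left h1)
  · exact Ideal.mem_sup_left (Ideal.pow_mem_of_mem _ (hy b) _ (Nat.pos_of_ne_zero hm))

/-! ### The `μₘ`-action (1.17) -/

/-- The twist `γ_ζ` of (1.17): `x_{r+1} ↦ ζ x_{r+1}`, `y_{s+1} ↦ ζ y_{s+1}`, all other coordinates
fixed, as an `R`-algebra map of the homogeneous coordinate ring of `ℙ^{r+1} × ℙ^{s+1}`.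
[cite: ShiodaKatsura1979, §1 (1.17)] -/
noncomputable def twist (ζ : R) :
    MvPolynomial (Option α ⊕ Option β) R →ₐ[R] MvPolynomial (Option α ⊕ Option β) R :=
  aeval (Sum.elim (fun v : Option α => v.elim (C ζ * X (Sum.inl none)) fun a => X (Sum.inl (some a)))
    (fun w : Option β => w.elim (C ζ * X (Sum.inr none)) fun b => X (Sum.inr (some b))))

/-- (1.17): `x_{r+1} ↦ ζ x_{r+1}`. [cite: ShiodaKatsura1979, §1 (1.17)] -/
@[simp] theorem twist_X_inl_none (ζ : R) :
    twist (α := α) (β := β) ζ (X (Sum.inl none)) = C ζ * X (Sum.inl none) := by simp [twist]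

/-- (1.17): `y_{s+1} ↦ ζ y_{s+1}`. [cite: ShiodaKatsura1979, §1 (1.17)] -/
@[simp] theorem twist_X_inr_none (ζ : R) :
    twist (α := α) (β := β) ζ (X (Sum.inr none)) = C ζ * X (Sum.inr none) := by simp [twist]

/-- (1.17): `x_i ↦ x_i` for `i ≤ r`. [cite: ShiodaKatsura1979, §1 (1.17)] -/
@[simp] theorem twist_X_inl_some (ζ : R) (a : α) :
    twist (α := α) (β := β) ζ (X (Sum.inl (some a))) = X (Sum.inl (some a)) := by simp [twist]

/-- (1.17): `y_j ↦ y_j` for `j ≤ s`. [cite: ShiodaKatsura1979, §1 (1.17)] -/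
@[simp] theorem twist_X_inr_some (ζ : R) (b : β) :
    twist (α := α) (β := β) ζ (X (Sum.inr (some b))) = X (Sum.inr (some b)) := by simp [twist]

/-- **(1.17) is compatible with `φ`:** the twist multiplies EVERY coordinate `φ^*(z_v)` of `φ` by `ζ`,
so `φ ∘ γ_ζ = φ` as a map to `ℙ^{r+s+1}` ("Since `ψ` is compatible with the `μₘ`-action …", proof of
Lemma 1.6). [cite: ShiodaKatsura1979, §1 (1.17), Lemma 1.6] -/
theorem twist_skSubst (ζ ε : R) (v : α ⊕ β) :
    twist ζ (skSubst (α := α) (β := β) ε v) = C ζ * skSubst ε v := by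
  rcases v with a | b
  · simp only [skSubst_inl, map_mul, twist_X_inl_some, twist_X_inr_none]; ring
  · simp only [skSubst_inr, map_mul, algHom_C, algebraMap_eq, twist_X_inl_none, twist_X_inr_some]
    ring

/-- Hence on a form `p(z)` of degree `k`: `γ_ζ^* φ^* p = ζᵏ · φ^* p`.
[cite: ShiodaKatsura1979, §1 (1.17), Lemma 1.6] -/
theorem twist_skMap (ζ ε : R) {k : ℕ} {p : MvPolynomial (α ⊕ β) R} (hp : p.IsHomogeneous k) :
    twist ζ (skMap ε p) = C ζ ^ k * skMap ε p := by
  unfold skMap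
  rw [← AlgHom.comp_apply, comp_aeval]
  have h : (fun v => twist ζ (skSubst (α := α) (β := β) ε v)) = fun v => C ζ * skSubst ε v :=
    funext (twist_skSubst ζ ε)
  rw [h, aeval_const_mul_of_isHomogeneous hp]

/-- The twist preserves the equation of `Xʳ`: `γ_ζ^*(f(x) + x_∞ᵐ) = f(x) + ζᵐ x_∞ᵐ`, `= f(x) + x_∞ᵐ`
for `ζ ∈ μₘ` — (1.17) is an action on `Xʳ × Xˢ`. [cite: ShiodaKatsura1979, §1 (1.17)] -/
theorem twist_coneForm_inl {ζ : R} {m : ℕ} (hζ : ζ ^ m = 1) (f : MvPolynomial α R) :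
    twist (α := α) (β := β) ζ (rename Sum.inl (coneForm m f)) = rename Sum.inl (coneForm m f) := by
  rw [rename_inl_coneForm, map_add, map_pow, twist_X_inl_none, mul_pow, ← map_pow, hζ, map_one,
    one_mul, ← aeval_X_left_apply (rename (Sum.inl ∘ some) f), aeval_rename, ← AlgHom.comp_apply,
    comp_aeval]
  have h : (fun a : α => twist (α := α) (β := β) ζ ((X ∘ Sum.inl ∘ some) a)) =
      (X ∘ Sum.inl ∘ some : α → MvPolynomial (Option α ⊕ Option β) R) :=
    funext fun a => by simp
  rw [h]

/-- The twist preserves the equation of `Xˢ` (`ζ ∈ μₘ`). [cite: ShiodaKatsura1979, §1 (1.17)] -/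
theorem twist_coneForm_inr {ζ : R} {m : ℕ} (hζ : ζ ^ m = 1) (g : MvPolynomial β R) :
    twist (α := α) (β := β) ζ (rename Sum.inr (coneForm m g)) = rename Sum.inr (coneForm m g) := by
  rw [rename_inr_coneForm, map_add, map_pow, twist_X_inr_none, mul_pow, ← map_pow, hζ, map_one,
    one_mul, ← aeval_X_left_apply (rename (Sum.inr ∘ some) g), aeval_rename, ← AlgHom.comp_apply,
    comp_aeval]
  have h : (fun b : β => twist (α := α) (β := β) ζ ((X ∘ Sum.inr ∘ some) b)) =
      (X ∘ Sum.inr ∘ some : β → MvPolynomial (Option α ⊕ Option β) R) :=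
    funext fun b => by simp
  rw [h]

/-- The fixed locus of (1.17) contains `Y`: the twist fixes every coordinate other than `x_∞, y_∞`,
and moves those two by the factor `ζ`, so for `ζ ≠ 1` (and `1 - ζ` a non-zero-divisor) a fixed point
has `x_∞ = y_∞ = 0` ("The fixed point set of this action is the subvariety `Y` defined before").
Polynomial form: `γ_ζ^* x_∞ - x_∞ = (ζ - 1) x_∞`, `γ_ζ^* y_∞ - y_∞ = (ζ - 1) y_∞`.
[cite: ShiodaKatsura1979, §1 (1.17)] -/
theorem twist_sub_self_none (ζ : R) :
    twist (α := α) (β := β) ζ (X (Sum.inl none)) - X (Sum.inl none) = C (ζ - 1) * X (Sum.inl none) ∧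
      twist (α := α) (β := β) ζ (X (Sum.inr none)) - X (Sum.inr none) =
        C (ζ - 1) * X (Sum.inr none) := by
  constructor <;> simp [map_sub, sub_mul]

end Literature.AlgebraicGeometry.ShiodaKatsura1979
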